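import Literature.Barriers.QuantumAdvantage.AaronsonChenLearningAnalysis
import Literature.Barriers.QuantumAdvantage.PPolyOraclesProofs
import HarnessLib

/-!
# Aaronson–Chen 2017, Lemma 8.2: the polynomial budget, the machine fact, and the reduction of `aaronsonChen2017_lem82`

Third file of the decomposition of the named fact
`Literature.Barriers.QuantumAdvantage.aaronsonChen2017_lem82` (`PPolyOraclesProofs.lean`;
S. Aaronson, L. Chen, CCC 2017, arXiv:1612.05903 [AaronsonChen2017], **Lemma 8.2**, p. 32),
after `AaronsonChenLearning.lean` (the ideal PAC-learning replacement process `AcLearn.process`,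
its output law `AcLearn.learnLaw`) and `AaronsonChenLearningAnalysis.lean` (its analysis
`AcLearn.tvDist_kernel_learnLaw_le`: `Δ(𝒟^M, learnLaw) ≤ T·δ + 2T√ε₁` whenever
`|hypClass q k|(1 − ε₁)^m ≤ δ`).

**What this file adds.**

* The ARITHMETIC of "a `poly(n, ε₁⁻¹, ln δ₁⁻¹)` number of i.i.d. samples" (p. 33): with
  `M = N + T + 2` (`N` wires, `T` oracle gates), `√ε₁ = 1/8M²`, `δ = 1/4M²`, and `d ≥ 2` with
  `q(n) ≤ (n+2)^d` (`natPoly_exists_le_pow`), the budget `m = M^{3d+15}` (`AcLearn.budget`) gives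
  `|hypClass q k|(1 − ε₁)^m ≤ 2^{(N+q(N)+3)(q(N)+4)²} e^{−ε₁ m} ≤ δ` (`stage_bound`) and
  `T·δ + 2T√ε₁ ≤ 1/2k` for `k ≤ N` (`final_bound`); whence
  `AcLearn.exists_budget_tvDist_kernel_learnLaw_le` (any unitary gate set) and
  **`aaronsonChen2017_lem82_analysis`** (PROVED): for every Clifford+T query-circuit family `F`
  and polynomial `q` there is `c` such that for every admissible rule, every post-processing,
  every `O ∈ SIZE(q)` and every input `⟨x, 1^k⟩`, the learner's law `acLearnPMF` with budget
  exponent `c` is within statistical distance `1/2k` of `𝒟^M = (F.kernel O ⟨x,1^k⟩).map post`.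
* **`aaronsonChen2017_lem82_machine`** (NAMED FACT) — the remaining, machine-level half of the
  printed proof ("Showing that `A` is a `SampBPP` algorithm", p. 33: sampling from `Q` is a
  `SampBQP` task hence in `SampBPP` by `SampBPP = SampBQP`; finding a consistent
  `g ∈ SIZE(q(n))` is an `NP` search hence in `BPP` by `NP ⊆ BPP`; measuring `V|0⟩` is again in
  `SampBPP`; "Therefore, `A` is a `SampBPP` oracle algorithm"): under the two hypotheses, for
  every `q`, every `SampBQP` oracle algorithm `(F, post)` and every budget exponent `c` there are
  a PPT oracle adversary `𝒜` AND an oracle-independent family of admissible selection rules such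
  that for every `O ∈ SIZE(q)` the output law of `𝒜^O` on `⟨x, 1^k⟩` is within `1/2k` of the
  ideal learner's law with those rules. (The rules are quantified BEFORE the oracle: a rule
  allowed to depend on `O` could answer `O` itself — `AcLearn.learnLaw_pure_self` — and the fact
  would collapse to Lemma 8.2.)
* **`aaronsonChen2017_lem82_of_machine`** (PROVED): Lemma 8.2 — the tree fact
  `aaronsonChen2017_lem82`, accuracy `1/k` — from the machine fact and the proved analysis, by the
  triangle inequality; and `PPolyOracles_of_leaves_machine`, the entry-file barrier from its leaves
  with `aaronsonChen2017_lem82` replaced by `aaronsonChen2017_lem82_machine`.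

## What remains for `aaronsonChen2017_lem82_holds`

Exactly `aaronsonChen2017_lem82_machine`: a PPT `OracleAdversary` that (i) samples
`queryMarginal` of the replaced-run prefix state to accuracy `1/poly` through a uniform
`SampBQP = SampP` sampler fed the learned circuits (needs a universal Clifford+T compiler for
`B₂`-circuits in the tree's `QCircuitFamily`/`IsUniform` model), (ii) finds a consistent
size-`q(k)` circuit by an `NP ⊆ BPP` search-to-decision procedure with amplified error, (iii)
samples the final replaced circuit likewise; its law is then within `T(m·η₁ + η₂) + η₃ ≤ 1/2k`
of `acLearnPMF` for the conditional-on-success selection rules — each step a theory in the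
tree's machine models (compare `aaronsonChen2017_lem53_machine`).

## Sources

* [AaronsonChen2017] arXiv:1612.05903, pp. 32–33 (Lemma 8.2 and its proof), read via
  `lit read arxiv:1612.05903`.
-/

noncomputable section

namespace Literature.Barriers.QuantumAdvantage

open _root_.Computability Literature.Computability.Complexity Literature.Computability.Cryptography
  Literature.Computability.QuantumComplexity Literature.Computability.Learning
open Literature.Computability.Complexity.Classes Literature.Computability.Complexity.Nondeterministic
open Matrix
open scoped ENNReal

variable {G : QGateSet}

namespace AcLearn

/-! ### The budget: per-gate Occam bound and the final constant -/

/-- All hypothesis classes of query width `k ≤ N` are bounded by the one exponent at `N`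
(`q` is monotone). [folklore] -/
theorem card_hypClass_le_of_le {q : Polynomial ℕ} {k N : ℕ} (h : k ≤ N) :
    (hypClass q k).card ≤ 2 ^ ((N + q.eval N + 3) * (q.eval N + 4) ^ 2) := by
  refine (card_hypClass_le q k).trans (Nat.pow_le_pow_right (by norm_num) ?_)
  have hq : q.eval k ≤ q.eval N := natPoly_eval_mono q h
  exact Nat.mul_le_mul (by omega) (Nat.pow_le_pow_left (by omega) 2)

/-- The budget inequality in `ℝ`: `E + 2M + 2 ≤ ε₁ · m` for `ε₁ = (1/8M²)²`, `m = M^{3d+15}`. [folklore] -/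
theorem key_real {M d E : ℕ} (hM : 2 ≤ M) (hE : E ≤ M ^ (3 * d + 4)) :
    ((E + 2 * M + 2 : ℕ) : ℝ) ≤ (1 / (8 * (M : ℝ) ^ 2)) ^ 2 * ((M ^ (3 * d + 15) : ℕ) : ℝ) := by
  have h1 : ((64 * M ^ 4 * (E + 2 * M + 2) : ℕ) : ℝ) ≤ ((M ^ (3 * d + 15) : ℕ) : ℝ) := by
    exact_mod_cast budget_mul_le_pow (d := d) hM hE
  have hM0 : (0 : ℝ) < (M : ℝ) := by
    have : (2 : ℝ) ≤ M := by exact_mod_cast hM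
    linarith
  have h64 : (0 : ℝ) < 64 * (M : ℝ) ^ 4 := by positivity
  have h2 : (1 / (8 * (M : ℝ) ^ 2)) ^ 2 * ((M ^ (3 * d + 15) : ℕ) : ℝ) =
      ((M ^ (3 * d + 15) : ℕ) : ℝ) / (64 * (M : ℝ) ^ 4) := by
    field_simp
    ring
  rw [h2, le_div_iff₀ h64]
  calc ((E + 2 * M + 2 : ℕ) : ℝ) * (64 * (M : ℝ) ^ 4) =
        ((64 * M ^ 4 * (E + 2 * M + 2) : ℕ) : ℝ) := by
        push_cast
        ring
    _ ≤ ((M ^ (3 * d + 15) : ℕ) : ℝ) := h1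

/-- **The per-gate Occam bound under the budget**: for `q(n) ≤ (n+2)^d` (`d ≥ 2`) and `k < N`,
`|hypClass q k| · (1 − ε₁)^m ≤ 1/4M²` with `ε₁ = (1/8M²)²`, `m = (N + T + 2)^{3d+15}`,
`M = N + T + 2`. [cite: AaronsonChen2017, §8 (proof of Lemma 8.2, "a poly(n, ε₁⁻¹, ln δ₁⁻¹) number of i.i.d. samples", p. 33)] -/
theorem stage_bound {q : Polynomial ℕ} {d : ℕ} (hd : 2 ≤ d) (hq : ∀ n, q.eval n ≤ (n + 2) ^ d)
    {N T k : ℕ} (hk : k < N) :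
    ((hypClass q k).card : ℝ) *
        (1 - (1 / (8 * ((N + T + 2 : ℕ) : ℝ) ^ 2)) ^ 2) ^ budget (3 * d + 15) N T ≤
      1 / (4 * ((N + T + 2 : ℕ) : ℝ) ^ 2) := by
  set M := N + T + 2 with hM
  have hM2 : 2 ≤ M := by omega
  set η : ℝ := 1 / (8 * (M : ℝ) ^ 2) with hη
  have hMr : (2 : ℝ) ≤ M := by exact_mod_cast hM2
  have hη0 : 0 < η := by positivity
  have hη1 : η ≤ 1 := by
    rw [hη, div_le_one (by positivity)]
    nlinarith
  have hε2 : η ^ 2 ≤ 1 := pow_le_one₀ hη0.le hη1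
  set E := (N + q.eval N + 3) * (q.eval N + 4) ^ 2 with hE
  have hEle : E ≤ M ^ (3 * d + 4) :=
    exponent_le_pow hM2 hd (by omega) ((hq N).trans (Nat.pow_le_pow_left (by omega) d))
  have hcard : ((hypClass q k).card : ℝ) ≤ (2 : ℝ) ^ E := by
    exact_mod_cast card_hypClass_le_of_le (q := q) hk.le
  have hbud : budget (3 * d + 15) N T = M ^ (3 * d + 15) := rfl
  have hexp := one_sub_pow_le_exp_neg hε2 (budget (3 * d + 15) N T)
  have ht : ((E + 2 * M + 2 : ℕ) : ℝ) ≤ η ^ 2 * (budget (3 * d + 15) N T : ℕ) := by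
    rw [hbud, hη]
    exact key_real hM2 hEle
  calc ((hypClass q k).card : ℝ) * (1 - η ^ 2) ^ budget (3 * d + 15) N T
      ≤ (2 : ℝ) ^ E * Real.exp (-(η ^ 2 * (budget (3 * d + 15) N T : ℕ))) :=
        mul_le_mul hcard hexp (pow_nonneg (by linarith) _) (by positivity)
    _ ≤ 1 / (4 * (M : ℝ) ^ 2) := two_pow_mul_exp_neg_le (by omega) ht

/-- **The two halves fit in `1/2k`**: `T · (1/4M²) + 2T · √((1/8M²)²) ≤ 1/2k` for `1 ≤ k ≤ N`,
`M = N + T + 2`. [cite: AaronsonChen2017, §8 (proof of Lemma 8.2, "2T·√ε₁ = ε²/8" and "≤ ε", p. 33)] -/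
theorem final_bound {N T k : ℕ} (hk : 0 < k) (hkN : k ≤ N) :
    (T : ℝ) * (1 / (4 * ((N + T + 2 : ℕ) : ℝ) ^ 2)) +
        2 * (T : ℝ) * Real.sqrt ((1 / (8 * ((N + T + 2 : ℕ) : ℝ) ^ 2)) ^ 2) ≤
      1 / (2 * (k : ℝ)) := by
  set M := N + T + 2 with hM
  have hkM : k ≤ M := by omega
  have hTM : T ≤ M := by omega
  have hkr : (1 : ℝ) ≤ k := by exact_mod_cast hk
  have hkMr : (k : ℝ) ≤ M := by exact_mod_cast hkM
  have hTMr : (T : ℝ) ≤ M := by exact_mod_cast hTM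
  have hT0 : (0 : ℝ) ≤ T := Nat.cast_nonneg _
  have hM0 : (0 : ℝ) < M := by linarith
  rw [Real.sqrt_sq (by positivity)]
  have h1 : (T : ℝ) * (1 / (4 * (M : ℝ) ^ 2)) ≤ 1 / (4 * (k : ℝ)) := by
    rw [mul_one_div, div_le_div_iff₀ (by positivity) (by positivity), one_mul]
    calc (T : ℝ) * (4 * k) ≤ M * (4 * M) := by gcongr
      _ = 4 * (M : ℝ) ^ 2 := by ring
  have h2 : 2 * (T : ℝ) * (1 / (8 * (M : ℝ) ^ 2)) ≤ 1 / (4 * (k : ℝ)) := by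
    rw [mul_one_div, div_le_div_iff₀ (by positivity) (by positivity), one_mul]
    calc 2 * (T : ℝ) * (4 * k) ≤ 2 * M * (4 * M) := by gcongr
      _ = 8 * (M : ℝ) ^ 2 := by ring
  have h3 : 1 / (4 * (k : ℝ)) + 1 / (4 * (k : ℝ)) = 1 / (2 * (k : ℝ)) := by
    field_simp
    ring
  linarith

/-- **The analysis of Lemma 8.2 with a polynomial budget** (any unitary gate set): for every
family `F` and polynomial `q` there is an exponent `c` such that, with `(N + T + 2)^c` samples per
gate, for every admissible rule, post-processing, `O ∈ SIZE(q)` and input `w` with `k ≤ |w|`,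
`Δ((F.kernel O w).map post, learnLaw) ≤ 1/2k`. [cite: AaronsonChen2017, §8 (proof of Lemma 8.2, pp. 32–33)] -/
theorem exists_budget_tvDist_kernel_learnLaw_le (hG : G.IsUnitary) (F : QCircuitFamily G)
    (q : Polynomial ℕ) :
    ∃ c : ℕ, ∀ (sel : SelRule), Admissible q sel → ∀ (post : List Bool → List Bool)
      (O : Language Bool), O ∈ SIZE (fun n => q.eval n) → ∀ (w : List Bool) (k : ℕ), 0 < k →
        k ≤ w.length →
          ((F.kernel O w).map post).tvDist
              (learnLaw sel O (budget c (w.length + F.ancillas w.length)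
                (F.circ w.length).oracleQueries) F post w) ≤ 1 / (2 * (k : ℝ)) := by
  obtain ⟨d, hd, hq⟩ := natPoly_exists_le_pow q
  refine ⟨3 * d + 15, fun sel hsel post O hO w k hk hkw => ?_⟩
  have hη0 : (0 : ℝ) < (1 / (8 * ((w.length + F.ancillas w.length +
      (F.circ w.length).oracleQueries + 2 : ℕ) : ℝ) ^ 2)) ^ 2 := by
    positivity
  have hη1 : (1 / (8 * ((w.length + F.ancillas w.length +
      (F.circ w.length).oracleQueries + 2 : ℕ) : ℝ) ^ 2)) ^ 2 ≤ 1 := by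
    refine pow_le_one₀ (by positivity) ?_
    rw [div_le_one (by positivity)]
    have : (2 : ℝ) ≤ ((w.length + F.ancillas w.length +
        (F.circ w.length).oracleQueries + 2 : ℕ) : ℝ) := by
      exact_mod_cast (by omega : 2 ≤ w.length + F.ancillas w.length +
        (F.circ w.length).oracleQueries + 2)
    nlinarith
  have hmain := tvDist_kernel_learnLaw_le hG hsel hO (budget (3 * d + 15)
    (w.length + F.ancillas w.length) (F.circ w.length).oracleQueries) hη0 hη1
    (by positivity : (0 : ℝ) ≤ 1 / (4 * ((w.length + F.ancillas w.length +
      (F.circ w.length).oracleQueries + 2 : ℕ) : ℝ) ^ 2))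
    F post w (fun kq hkq => stage_bound hd hq hkq)
  exact hmain.trans (final_bound hk (hkw.trans (Nat.le_add_right _ _)))

end AcLearn

/-! ### Lemma 8.2: the analysis (proved), the machine (named fact), the reduction -/

/-- **The ideal learner's law with the polynomial budget**: `learnLaw` with
`(N + T + 2)^c` samples per gate on input `w` (`N = |w| + ancillas`, `T` the oracle gates of
`F.circ |w|`) — the distribution the `SampBPP` machine of Lemma 8.2 samples to within `1/2k`.
[cite: AaronsonChen2017, §8 (proof of Lemma 8.2, p. 33)] -/
def acLearnPMF (F : QCircuitFamily G) (post : List Bool → List Bool) (sel : AcLearn.SelRule)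
    (O : Language Bool) (c : ℕ) (w : List Bool) : PMF (List Bool) :=
  AcLearn.learnLaw sel O
    (AcLearn.budget c (w.length + F.ancillas w.length) (F.circ w.length).oracleQueries) F post w

/-- The accuracy parameter is below the input length: `k ≤ |⟨x, 1^k⟩|`. [folklore] -/
theorem le_length_boolPair_unaryEncodeNat (x : List Bool) (k : ℕ) :
    k ≤ (boolPair x (unaryEncodeNat k)).length := by
  have h : (unaryEncodeNat k).length = k := unary_decode_encode_nat k
  rw [length_boolPair, h]
  omega

/-- **Aaronson–Chen 2017, Lemma 8.2 — the analysis, PROVED**: for every Clifford+T query-circuit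
family `F` and polynomial `q` there is a budget exponent `c` such that for every admissible
selection rule, every post-processing `post`, every `O ∈ SIZE(q)` and every input `⟨x, 1^k⟩`
(`k ≥ 1`), the ideal learner's law is within statistical distance `1/2k` of
`𝒟^M = (F.kernel O ⟨x, 1^k⟩).map post` ("with probability at least `1 − ε/2` … `‖𝒟 − 𝒟^M‖ ≤ ε/2`",
in the tree's constants). [cite: AaronsonChen2017, Lemma 8.2 (proof, pp. 32–33)] -/
theorem aaronsonChen2017_lem82_analysis (F : QCircuitFamily cliffordT) (q : Polynomial ℕ) :
    ∃ c : ℕ, ∀ (sel : AcLearn.SelRule), AcLearn.Admissible q sel →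
      ∀ (post : List Bool → List Bool) (O : Language Bool), O ∈ SIZE (fun n => q.eval n) →
        ∀ (x : List Bool) (k : ℕ), 0 < k →
          ((F.kernel O (boolPair x (unaryEncodeNat k))).map post).tvDist
              (acLearnPMF F post sel O c (boolPair x (unaryEncodeNat k))) ≤ 1 / (2 * (k : ℝ)) := by
  obtain ⟨c, hc⟩ := AcLearn.exists_budget_tvDist_kernel_learnLaw_le cliffordT_isUnitary_holds F q
  exact ⟨c, fun sel hsel post O hO x k hk =>
    hc sel hsel post O hO _ k hk (le_length_boolPair_unaryEncodeNat x k)⟩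

/-- **Aaronson–Chen 2017, Lemma 8.2 — the `SampBPP^O` machine** ("Showing that `A` is a `SampBPP`
algorithm. … `A` needs to do the following non-trivial computations. • Taking a polynomial number
of samples from `Q`. This task is in `SampBQP` (no oracle involved) by definition. By our assumption
`SampBQP = SampBPP`, it can be done in `SampBPP`. • Finding a `g ∈ SIZE(q(n))` such that `g` agrees
with `f` on all the samples. This can be done in `NP`, so by our assumption `NP ⊆ BPP`, it can be
done in `BPP`. • Taking a sample by measuring `V|0⟩^{⊗N}`. Again, this task is in `SampBQP`, and
hence can be done in `SampBPP` by our assumption. Therefore, `A` is a `SampBPP` oracle algorithm."):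
in the tree's models — suppose `SampBPP = SampBQP` and `NP ⊆ BPP`; then for every polynomial `q`,
every `SampBQP` oracle algorithm in canonical form (a poly-time uniform Clifford+T query-circuit
family `F` and a polynomial-time post-processing `post`) and every budget exponent `c`, there are a
PPT oracle adversary `𝒜` and a family, indexed by the input word, of selection rules admissible
for `q` — both independent of the oracle — such that for EVERY `O ∈ SIZE(q)`, every `x` and
`k ≥ 1`, the output law of `𝒜` run with oracle `O` on `⟨x, 1^k⟩` is within statistical distance
`1/2k` of the ideal learner's law `acLearnPMF F post (sel ⟨x,1^k⟩) O c ⟨x, 1^k⟩` (the machine's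
samples from `Q_t`, its `BPP` search and its final sample are each `1/poly`-accurate, and its
search, conditioned on success, is such a rule). Needs, beyond the tree: a uniform `SampBQP`
sampler for Clifford+T circuits with spliced-in `B₂`-circuits and its `SampP` simulation under the
hypothesis, `NP ⊆ BPP` search-to-decision with amplification as an `OracleAdversary` subroutine,
and the composition of these as one `IsPPT` adversary.
[cite: AaronsonChen2017, §8 (proof of Lemma 8.2, "Showing that A is a SampBPP algorithm", p. 33)] -/
def aaronsonChen2017_lem82_machine : Prop :=
  SampP = SampBQP → NP ⊆ BPP →
    ∀ (q : Polynomial ℕ) (F : QCircuitFamily cliffordT) (post : List Bool → List Bool),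
      F.IsUniform →
      PolyTimeComputable (id : List Bool → List Bool) (id : List Bool → List Bool) post →
      ∀ c : ℕ, ∃ 𝒜 : OracleAdversary (List Bool), 𝒜.IsPPT (encodingList Bool) ∧
        ∃ sel : List Bool → AcLearn.SelRule, (∀ w, AcLearn.Admissible q (sel w)) ∧
          ∀ O : Language Bool, O ∈ SIZE (fun n => q.eval n) → ∀ (x : List Bool) (k : ℕ), 0 < k →
            (PMF.map (fun o => o.getD [])
                (𝒜.outputPMF (Oracle.ofLanguage O) (boolPair x (unaryEncodeNat k)))).tvDist
              (acLearnPMF F post (sel (boolPair x (unaryEncodeNat k))) O c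
                (boolPair x (unaryEncodeNat k))) ≤ 1 / (2 * (k : ℝ))

/-- **Lemma 8.2 from the machine fact** (the analysis being proved): on `⟨x, 1^k⟩`,
`‖𝒟^M − 𝒟^A‖ ≤ ‖𝒟^M − 𝒟^{ideal}‖ + ‖𝒟^{ideal} − 𝒟^A‖ ≤ 1/2k + 1/2k = 1/k`
(`aaronsonChen2017_lem82_analysis`, `PMF.tvDist_triangle_holds`).
[cite: AaronsonChen2017, Lemma 8.2 (p. 32; proof pp. 32–33)] -/
theorem aaronsonChen2017_lem82_of_machine (h : aaronsonChen2017_lem82_machine) :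
    aaronsonChen2017_lem82 := by
  intro hS hNP q F post hU hpost
  obtain ⟨c, hc⟩ := aaronsonChen2017_lem82_analysis F q
  obtain ⟨𝒜, h𝒜, sel, hsel, hsim⟩ := h hS hNP q F post hU hpost c
  refine ⟨𝒜, h𝒜, fun O hO x k hk => ?_⟩
  set w := boolPair x (unaryEncodeNat k) with hw
  have h₁ := hc (sel w) (hsel w) post O hO x k hk
  have h₂ := hsim O hO x k hk
  rw [PMF.tvDist_comm] at h₂
  have hk' : (k : ℝ) ≠ 0 := by exact_mod_cast hk.ne'
  calc ((F.kernel O w).map post).tvDist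
        (PMF.map (fun o => o.getD []) (𝒜.outputPMF (Oracle.ofLanguage O) w))
      ≤ ((F.kernel O w).map post).tvDist (acLearnPMF F post (sel w) O c w) +
          (acLearnPMF F post (sel w) O c w).tvDist
            (PMF.map (fun o => o.getD []) (𝒜.outputPMF (Oracle.ofLanguage O) w)) :=
        PMF.tvDist_triangle_holds _ _ _
    _ ≤ 1 / (2 * (k : ℝ)) + 1 / (2 * (k : ℝ)) := add_le_add h₁ h₂
    _ = 1 / (k : ℝ) := by
        field_simp
        ring

/-- **`PPolyOracles` from its leaves, with Lemma 8.2 replaced by its machine half**: the eight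
hypotheses of `PPolyOracles_of_leaves` with `aaronsonChen2017_lem82` now derived from
`aaronsonChen2017_lem82_machine`. [cite: AaronsonChen2017, Thm. 7.6, Thm. 8.1, Lemma 7.4, Lemma 8.2] -/
theorem PPolyOracles_of_leaves_machine (hHILL : PRGExist_iff_OWFExist) (hGGM : PRFExist_of_PRGExist)
    (hLR : PRPExist_of_PRFExist) (h76 : aaronsonChen2017_thm76_of_prp)
    (h82 : aaronsonChen2017_lem82_machine) (h₂ : SampPRel_subset_SampBQPRel)
    (h₃ : BPPRel_ofLanguage_subset_BQPRel) (h₄ : BQPRel_subset_BPPRel_of_sampBQPRel_subset) :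
    PPolyOracles :=
  PPolyOracles_of_leaves hHILL hGGM hLR h76 (aaronsonChen2017_lem82_of_machine h82) h₂ h₃ h₄

end Literature.Barriers.QuantumAdvantage

end
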